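import Summits.HodgeConjecture.CorCM.MultiFieldWeilTwinUnitsMany
import Summits.HodgeConjecture.CorCM.MultiFieldWeilNonIsomorphicFamilies
import HarnessLib

/-!
# MULTI-FIELD WEIL ENGINE — SEVERAL TWIN UNITS, REALISED: the Hodge conjecture for every product of copies of a family with ANY number of twin pairs of slots (each pair = two
# types of one field read in ONE frame), given the single-slot Weil spaces (frame form)

Cell `pub-hodgecm2` (COR-CM), seat b30 gen 37 (2026-08-25); count-neutral own lane MULTI-FIELD WEIL ENGINE (stem `MultiFieldWeil*`), sequel of
`CorCM/MultiFieldWeilTwinUnitsMany.lean` (T1b, census: several twin pairs) in the pattern of `CorCM/MultiFieldWeilTwinRealised.lean` (T2: one pair).  Theorems only; no definition,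
no named fact, no `sorry`.  HONEST FRAMING: conditional on the displayed single-slot Weil-space binders `hW m`; `HC_CM` is NOT proved and not asserted.

* §1 `exists_hasDefectsG_realisedTuples_of_twins` — T1b's defect law `exists_hasDefectsG_of_twinsStabiliserTransitive` for the realised tuples (closed, non-empty, transitive on
  every slot BY NAME: `mul_mem_realisedTuples`, `inv_mem_realisedTuples`, `realisedTuples_nonempty`, `transitive_realisedTuples`).
* §2 **`hodgeConjectureFor_biproduct_comp_of_twins_frames`** — THE HEADLINE (frame form): `k = Kf i₀` imaginary quadratic, `E = A 0 ⊨ (k; {τ})`, `B_m = A (m+1) ⊨ (K_m; Φ (m+1))`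
  over CM fields `K_m ⊇ i_m(k)` of PRIME relative degrees `n_m`, types read by frames `e m` at position sets `P m`; the TWIN PAIRS are the `2`-element fibres `{m, tw m}` of an
  involution `tw` of the slots (one size `≥ 3`, realised tuples DIAGONAL on the pair, `2`-transitive, singleton position sets `{q m} ≠ {q (tw m)}`); realised tuples trivial on a
  unit `{m₀, tw m₀}` transitive on every slot outside it.  Then the Hodge conjecture holds for EVERY product of copies `⨁_j A(κ j)`, GIVEN the single-slot Weil spaces
  (`hodgeConjectureFor_biproduct_comp_of_defectLawG` with §1 as the defect law); dominated form.  The sextic reading (each twin pair = two primitive types of one non-Galois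
  `k·F⁺`; SEVERAL such doubled fields over one `k`) follows `CorCM/MultiFieldWeilTwinSextics.lean` verbatim and is the sequel.
[cite: Pohlmann1968, Thm 1] [cite: MoonenZarhin1995Duke, Thm. 2.4] [cite: Milne2020HodgeClassesAV, 1.2 (a) and Thm. 1] [cite: DixonMortimer1996, §1.6 and Thm. 1.6A; §2.1]
[cite: Shimura1998, §18.2 Lemma (i)]

## References
* [Pohlmann1968] H. Pohlmann, Ann. of Math. 88 (1968), Thm 1.  [MoonenZarhin1995Duke] B. Moonen, Yu. Zarhin, Duke Math. J. 77 (1995), Thm. 2.4.  [Milne2020HodgeClassesAV]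
  J. S. Milne, arXiv:2010.08857, 1.2 (a), Thm. 1.  [DixonMortimer1996] J. D. Dixon, B. Mortimer, *Permutation Groups*, GTM 163.  [Shimura1998] G. Shimura, CM book, §18.2.
-/

noncomputable section

open CategoryTheory CategoryTheory.Limits NumberField IntermediateField

namespace Summit.HodgeConjecture.CorCM.MultiFieldWeil

open Finset
open Literature.AlgebraicGeometry Literature.AlgebraicGeometry.Motives Literature.AlgebraicGeometry.HodgeTheory
open Literature.AlgebraicGeometry.ComplexMultiplication (IsCMTypeRealisation)
open Literature.AlgebraicTopology.SingularHomology
open Literature.NumberTheory.ComplexMultiplication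
open Summit.HodgeConjecture.CorCM.Census.MultiFieldWeil

open scoped Classical

/-! ## §1 The defect law for realised tuples with several twin pairs -/

section Realised

variable {I : Type} {r : ℕ} {Kf : I → Type} [∀ i, Field (Kf i)] [∀ i, NumberField (Kf i)] {i₀ : I} {is : Fin r → I} {n : Fin r → ℕ}
  {e : ∀ m : Fin r, (Kf (is m) →+* ℂ) ≃ Fin (n m) × Bool} {τ : Kf i₀ →+* ℂ} {im : ∀ m : Fin r, Kf i₀ →+* Kf (is m)}
  (he_sign : ∀ (m : Fin r) (s : Kf (is m) →+* ℂ), (e m s).2 = true ↔ s.comp (im m) = τ)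

include he_sign in
/-- **THE DEFECT LAW FOR REALISED TUPLES WITH SEVERAL TWIN PAIRS** (`CorCM/MultiFieldWeilTwinUnitsMany` for the realised tuples: PRIME relative degrees, proper non-empty position
sets, twin pairs = the `2`-element fibres of an involution `tw` — one size `≥ 3`, diagonal realised tuples, `2`-transitive, singleton position sets `{q m} ≠ {q (tw m)}` —, realised
tuples trivial on a unit transitive on every slot outside it). [cite: MoonenZarhin1995Duke, Thm. 2.4] [cite: Shimura1998, §18.2 Lemma (i)] [cite: DixonMortimer1996, §1.6 and
Thm. 1.6A; §2.1] -/
theorem exists_hasDefectsG_realisedTuples_of_twins (hpr : ∀ m, (n m).Prime)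
    (tw : Fin r → Fin r) (htw : ∀ m, tw (tw m) = m) (hn : ∀ m, n (tw m) = n m) (h3 : ∀ m, tw m ≠ m → 3 ≤ n m)
    (hdiag : ∀ π ∈ realisedTuples e τ, ∀ m, tw m ≠ m → ∀ a : Fin (n (tw m)), Fin.cast (hn m) (π (tw m) a) = π m (Fin.cast (hn m) a))
    (h2t : ∀ m, tw m ≠ m → ∀ a a' b b' : Fin (n m), a ≠ a' → b ≠ b' → ∃ π ∈ realisedTuples e τ, π m a = b ∧ π m a' = b')
    (hstab : ∀ (m₀ m : Fin r), m₀ ≠ m → tw m₀ ≠ m → ∀ a a' : Fin (n m), ∃ ν ∈ realisedTuples e τ, ν m₀ = 1 ∧ ν (tw m₀) = 1 ∧ ν m a = a')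
    {P : ∀ m : Fin r, Finset (Fin (n m))} (hP0 : ∀ m, (P m).Nonempty) (hPn : ∀ m, (P m).card < n m)
    (q : ∀ m : Fin r, Fin (n m)) (hPq : ∀ m, tw m ≠ m → P m = {q m}) (hq : ∀ m, tw m ≠ m → Fin.cast (hn m) (q (tw m)) ≠ q m)
    (c : Fin r → ℕ) (hc : ∀ m, ((c m : ℕ) : ℤ) = (n m : ℤ) - 2 * (P m).card)
    {α : Type} (v : α → PtG n) (T : Finset α) (hT : ModelBalancedG P (realisedTuples e τ) v T) : ∃ t : Fin r → ℤ, HasDefectsG c v T t :=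
  exists_hasDefectsG_of_twinsStabiliserTransitive (fun _ hπ _ hπ' => mul_mem_realisedTuples e τ hπ hπ') (fun _ hπ => inv_mem_realisedTuples hπ)
    (realisedTuples_nonempty (e := e) he_sign) (fun m a b => transitive_realisedTuples (e := e) he_sign m a b) tw htw hn h3 hdiag h2t hstab hpr hP0 hPn q hPq hq c hc v T hT

end Realised

/-! ## §2 The headline, frame form -/

section Headline

variable {I : Type} {r : ℕ} {Kf : I → Type} [∀ i, Field (Kf i)] [∀ i, NumberField (Kf i)] [∀ i, IsCMField (Kf i)]
  {i₀ : I} {is : Fin r → I} {n : Fin r → ℕ} {τ : Kf i₀ →+* ℂ}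
  {A : Fin (r + 1) → AbelianVariety ℂ} {Φ : ∀ j : Fin (r + 1), CMType (Kf (mfSlots i₀ is j))}
  {ι : ∀ j, 𝓞 (Kf (mfSlots i₀ is j)) →+* End (A j)}
  {θ : ∀ j, Kf (mfSlots i₀ is j) →+* Module.End ℂ (complexBetti (A j).X 1)}

/-- **HEADLINE (frame form) — PRIME RELATIVE DEGREES WITH SEVERAL TWIN PAIRS OF SLOTS, GIVEN THE SINGLE-SLOT WEIL SPACES.**  `k = Kf i₀` imaginary quadratic,
`E = A 0 ⊨ (k; {τ})` (`τ(δ) = i√d`), `B_m = A (m+1) ⊨ (K_m; Φ (m+1))` over CM fields `K_m ⊇ i_m(k)` of PRIME `n_m = [K_m : k]`, types read by frames `e m` at position sets `P m`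
of sizes `p_m` (`0 < p_m`, `2 p_m ≤ n_m`); TWIN PAIRS = the `2`-element fibres `{m, tw m}` of an involution `tw` of `Fin r` (one size `≥ 3`, realised tuples diagonal on the pair
and `2`-transitive, `P m = {q m}`, `q (tw m) ≠ q m` under the identification); the realised tuples trivial on a unit `{m₀, tw m₀}` transitive on every slot outside it.  Then the
Hodge conjecture holds for EVERY product of copies `⨁_j A(κ j)` GIVEN the single-slot Weil spaces `hW m`.  `HC_CM` is NOT asserted. [cite: Pohlmann1968, Thm 1]
[cite: MoonenZarhin1995Duke, Thm. 2.4] [cite: Milne2020HodgeClassesAV, 1.2 (a) and Thm. 1] [cite: DixonMortimer1996, §1.6 and Thm. 1.6A; §2.1] -/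
theorem hodgeConjectureFor_biproduct_comp_of_twins_frames (P : ∀ m : Fin r, Finset (Fin (n m))) (p : Fin r → ℕ)
    (hcard : ∀ m, (P m).card = p m) (hpr : ∀ m, (n m).Prime) (hp0 : ∀ m, 0 < p m) (hpn : ∀ m, 2 * p m ≤ n m)
    {N : ℕ} (κ : Fin N → Fin (r + 1)) (h2 : Module.finrank ℚ (Kf i₀) = 2) (im : ∀ m : Fin r, Kf i₀ →+* Kf (is m))
    {δ : 𝓞 (Kf i₀)} {d : ℕ} (hτ : τ (δ : Kf i₀) = Complex.I * (Real.sqrt d : ℂ))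
    (hA : ∀ j, IsCMTypeRealisation (Φ j) (A j) (ι j) (θ j))
    (e : ∀ m : Fin r, (Kf (is m) →+* ℂ) ≃ Fin (n m) × Bool)
    (he_sign : ∀ (m : Fin r) (s : Kf (is m) →+* ℂ), (e m s).2 = true ↔ s.comp (im m) = τ)
    (he_conj : ∀ (m : Fin r) (s : Kf (is m) →+* ℂ), e m (ComplexEmbedding.conjugate s) = ((e m s).1, !(e m s).2))
    (hΨ : ∀ σ : Kf i₀ →+* ℂ, σ ∈ (Φ 0).1 ↔ σ = τ)
    (hΦ : ∀ (m : Fin r) (s : Kf (is m) →+* ℂ), s ∈ (Φ m.succ).1 ↔ (e m s).2 = decide ((e m s).1 ∈ P m))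
    (tw : Fin r → Fin r) (htw : ∀ m, tw (tw m) = m) (hn : ∀ m, n (tw m) = n m) (h3 : ∀ m, tw m ≠ m → 3 ≤ n m)
    (hdiag : ∀ π ∈ realisedTuples e τ, ∀ m, tw m ≠ m → ∀ a : Fin (n (tw m)), Fin.cast (hn m) (π (tw m) a) = π m (Fin.cast (hn m) a))
    (h2t : ∀ m, tw m ≠ m → ∀ a a' b b' : Fin (n m), a ≠ a' → b ≠ b' → ∃ π ∈ realisedTuples e τ, π m a = b ∧ π m a' = b')
    (hstab : ∀ (m₀ m : Fin r), m₀ ≠ m → tw m₀ ≠ m → ∀ a a' : Fin (n m), ∃ ν ∈ realisedTuples e τ, ν m₀ = 1 ∧ ν (tw m₀) = 1 ∧ ν m a = a')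
    (q : ∀ m : Fin r, Fin (n m)) (hPq : ∀ m, tw m ≠ m → P m = {q m}) (hq : ∀ m, tw m ≠ m → Fin.cast (hn m) (q (tw m)) ≠ q m)
    (hW : ∀ m : Fin r, weilClassesOf (⨁ fun i => A (partSlots (n m - 2 * p m) m i))
      (biproduct.map fun i => ι (partSlots (n m - 2 * p m) m i) (δfam im δ (partSlots (n m - 2 * p m) m i))) (n m - p m) d ≤
      algebraicClasses (⨁ fun i => A (partSlots (n m - 2 * p m) m i)).X (n m - p m)) :
    HodgeConjectureFor (⨁ fun j => A (κ j)).dim (⨁ fun j => A (κ j)).X :=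
  hodgeConjectureFor_biproduct_comp_of_defectLawG (is := is) P (fun m => n m - 2 * p m) (fun m => n m - p m)
    (fun m => by have := hpn m; omega) (fun m => by have := hp0 m; have := hpn m; omega) κ h2 im hτ hA e he_sign he_conj hΨ hΦ
    (fun v T hT => exists_hasDefectsG_realisedTuples_of_twins (e := e) he_sign hpr tw htw hn h3 hdiag h2t hstab
      (fun m => Finset.card_pos.1 (by rw [hcard m]; exact hp0 m)) (fun m => by have := hpn m; have := hp0 m; rw [hcard m]; omega) q hPq hq
      (fun m => n m - 2 * p m) (cast_sub_two_mul_eq hcard hpn) v T hT) hW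

/-- **Dominated form.** [cite: MumfordAV1970, §19 Thm. 1 and p. 169] [cite: Pohlmann1968, Thm 1] -/
theorem hodgeConjectureFor_of_avDominatedBy_comp_of_twins_frames (P : ∀ m : Fin r, Finset (Fin (n m))) (p : Fin r → ℕ)
    (hcard : ∀ m, (P m).card = p m) (hpr : ∀ m, (n m).Prime) (hp0 : ∀ m, 0 < p m) (hpn : ∀ m, 2 * p m ≤ n m)
    {N : ℕ} (κ : Fin N → Fin (r + 1)) (h2 : Module.finrank ℚ (Kf i₀) = 2) (im : ∀ m : Fin r, Kf i₀ →+* Kf (is m))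
    {δ : 𝓞 (Kf i₀)} {d : ℕ} (hτ : τ (δ : Kf i₀) = Complex.I * (Real.sqrt d : ℂ))
    (hA : ∀ j, IsCMTypeRealisation (Φ j) (A j) (ι j) (θ j))
    (e : ∀ m : Fin r, (Kf (is m) →+* ℂ) ≃ Fin (n m) × Bool)
    (he_sign : ∀ (m : Fin r) (s : Kf (is m) →+* ℂ), (e m s).2 = true ↔ s.comp (im m) = τ)
    (he_conj : ∀ (m : Fin r) (s : Kf (is m) →+* ℂ), e m (ComplexEmbedding.conjugate s) = ((e m s).1, !(e m s).2))
    (hΨ : ∀ σ : Kf i₀ →+* ℂ, σ ∈ (Φ 0).1 ↔ σ = τ)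
    (hΦ : ∀ (m : Fin r) (s : Kf (is m) →+* ℂ), s ∈ (Φ m.succ).1 ↔ (e m s).2 = decide ((e m s).1 ∈ P m))
    (tw : Fin r → Fin r) (htw : ∀ m, tw (tw m) = m) (hn : ∀ m, n (tw m) = n m) (h3 : ∀ m, tw m ≠ m → 3 ≤ n m)
    (hdiag : ∀ π ∈ realisedTuples e τ, ∀ m, tw m ≠ m → ∀ a : Fin (n (tw m)), Fin.cast (hn m) (π (tw m) a) = π m (Fin.cast (hn m) a))
    (h2t : ∀ m, tw m ≠ m → ∀ a a' b b' : Fin (n m), a ≠ a' → b ≠ b' → ∃ π ∈ realisedTuples e τ, π m a = b ∧ π m a' = b')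
    (hstab : ∀ (m₀ m : Fin r), m₀ ≠ m → tw m₀ ≠ m → ∀ a a' : Fin (n m), ∃ ν ∈ realisedTuples e τ, ν m₀ = 1 ∧ ν (tw m₀) = 1 ∧ ν m a = a')
    (q : ∀ m : Fin r, Fin (n m)) (hPq : ∀ m, tw m ≠ m → P m = {q m}) (hq : ∀ m, tw m ≠ m → Fin.cast (hn m) (q (tw m)) ≠ q m)
    (hW : ∀ m : Fin r, weilClassesOf (⨁ fun i => A (partSlots (n m - 2 * p m) m i))
      (biproduct.map fun i => ι (partSlots (n m - 2 * p m) m i) (δfam im δ (partSlots (n m - 2 * p m) m i))) (n m - p m) d ≤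
      algebraicClasses (⨁ fun i => A (partSlots (n m - 2 * p m) m i)).X (n m - p m))
    {X : AbelianVariety ℂ} (hX : Domination.AVDominatedBy X (⨁ fun j => A (κ j))) : HodgeConjectureFor X.dim X.X :=
  Domination.hodgeConjectureFor_of_avDominatedBy
    (hodgeConjectureFor_biproduct_comp_of_twins_frames P p hcard hpr hp0 hpn κ h2 im hτ hA e he_sign he_conj hΨ hΦ tw htw hn h3 hdiag h2t hstab q hPq hq hW) hX

end Headline

end Summit.HodgeConjecture.CorCM.MultiFieldWeil

end
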